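import Summits.AnomalousDissipation.AnomalousDissipation.Theorems.SawtoothPulseCascadeK1LocalisedCascadePhaseOneModes

/-!
# K1loc, line `Spectral` / thin start — helper: THE EQUISPACED LARGE SIEVE AND PERIODIC WEIGHTS (S-D, «PeriodicSieve»)

Helper file of the prover lane on the crux `K1LocalisedCascade` (stmt-AnomalousDissipation-19491), route
`SawtoothPulseCascade` (S-D fibre ledger, third form of the mid-band term of the window lemma: on the fibre `n` the mid-band
piece is `∫_𝕋 |g^mid_n(y)|²·|c_n(y)|² dy` with `c_n` a trigonometric polynomial whose frequencies lie in the tracked range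
`|m| ≤ K` and `g^mid_n` EXACTLY `1/N_j`-periodic — the phase-`j` profile has `N_j` identical teeth).
* §1 `sum_range_exp_two_pi_mul_div`: the character sum `Σ_{r<N} e(qr/N) = N·[N ∣ q]`;
* §2 `card_filter_dvd_sub_le`: a residue class mod `N` meets `{m′ ∈ M}` (`M ⊆ [−K, K]`) in at most `2K/N + 1` points, and
  **`sum_sq_norm_trigEval_equispaced_le`** (equispaced large sieve): for `c(y) = Σ_{m∈M} a_m e(my)`, `M ⊆ [−K, K]`, every real
  `u` and `N ≥ 1`, `Σ_{r<N} ‖c(u + r/N)‖² ≤ (N + 2K)·Σ_{m∈M}‖a_m‖²` (expand, sum the characters, Schur/AM-GM on the classes);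
* §3 **`integral_periodic_mul_sq_norm_trigPoly_le`**: for a continuous `1/N`-periodic weight `w ≥ 0` on `𝕋`,
  `∫_𝕋 w·‖c‖² ≤ (1 + 2K/N)·(∫_𝕋 w)·Σ_{m∈M}‖a_m‖²` (average the sieve over the period cell, translation invariance of Haar).
With `w = |g^mid_n|²` (`∫w = E_n`, `…ChirpSidebandEnergy`) this bounds the mid-band term by `(1 + 2K/N_j)·E_n·‖c_n‖₂²` —
relative to the tracked `L²` energy, with no sup norm of `c_n` and no pointwise majorant of `g^mid_n`.
No definitions; nothing about the crux. [cite: Grafakos2014, Prop. 3.1.2 (5) and Prop. 3.2.7 (3)] [problem: turb]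
-/

-- `Summit.<Summit>.<Problem>`: single-conjunct summit, the duplicate namespace segment is deliberate.
set_option linter.dupNamespace false

noncomputable section

namespace Summit.AnomalousDissipation.AnomalousDissipation.Theorems.SawtoothPulseCascade.K1Start

open MeasureTheory Set Filter Topology Function Complex AddCircle
open scoped Real ComplexConjugate

/-! ## §1 The character sum over `N` equispaced points -/

/-- `Σ_{r<N} e(q·r/N) = N` if `N ∣ q` and `= 0` otherwise (`N ≥ 1`, `q ∈ ℤ`; geometric sum of an `N`-th root of unity).
[folklore] -/
theorem sum_range_exp_two_pi_mul_div {N : ℕ} (hN : 0 < N) (q : ℤ) :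
    ∑ r ∈ Finset.range N, Complex.exp (2 * π * I * q * r / N) = if (N : ℤ) ∣ q then (N : ℂ) else 0 := by
  have hNc : (N : ℂ) ≠ 0 := by exact_mod_cast hN.ne'
  set x : ℂ := Complex.exp (2 * π * I * q / N) with hx
  have hterm : ∀ r : ℕ, Complex.exp (2 * π * I * q * r / N) = x ^ r := by
    intro r
    rw [hx, ← Complex.exp_nat_mul]
    congr 1; ring
  simp_rw [hterm]
  have hxN : x ^ N = 1 := by
    rw [hx, ← Complex.exp_nat_mul, show (N : ℂ) * (2 * π * I * q / N) = q * (2 * π * I) by field_simp]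
    exact Complex.exp_int_mul_two_pi_mul_I q
  split_ifs with hdvd
  · obtain ⟨q', rfl⟩ := hdvd
    have hx1 : x = 1 := by
      rw [hx, show (2 * π * I * ((N * q' : ℤ) : ℂ) / N : ℂ) = q' * (2 * π * I) by push_cast; field_simp]
      exact Complex.exp_int_mul_two_pi_mul_I q'
    simp [hx1]
  · have hx1 : x ≠ 1 := by
      intro h1
      rw [hx, Complex.exp_eq_one_iff] at h1
      obtain ⟨n, hn⟩ := h1
      have h2πI : (2 * π * I : ℂ) ≠ 0 := by simp [Real.pi_ne_zero, Complex.I_ne_zero]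
      have h3 : 2 * π * I * q = 2 * π * I * (N * n) := by
        have h4 := congrArg (· * (N : ℂ)) hn
        simp only [div_mul_cancel₀ _ hNc] at h4
        rw [h4]; ring
      have hq : (q : ℂ) = (N : ℂ) * (n : ℂ) := mul_left_cancel₀ h2πI h3
      exact hdvd ⟨n, by exact_mod_cast hq⟩
    rw [geom_sum_eq hx1, hxN, sub_self, zero_div]

/-! ## §2 The equispaced large sieve -/

/-- A residue class mod `N ≥ 1` meets a finite `M ⊆ [−K, K]` in at most `2K/N + 1` points:
`#{m′ ∈ M : N ∣ m − m′} ≤ 2K/N + 1` (two points of the class differ by at least `N`). [folklore] -/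
theorem card_filter_dvd_sub_le {N : ℕ} (hN : 0 < N) {K : ℕ} (M : Finset ℤ) (hM : ∀ m ∈ M, |m| ≤ K) (m : ℤ) :
    ((M.filter fun m' : ℤ => (N : ℤ) ∣ m - m').card : ℤ) ≤ 2 * K / N + 1 := by
  classical
  have hNz : (N : ℤ) ≠ 0 := by exact_mod_cast hN.ne'
  have hNpos : (0 : ℤ) < N := by exact_mod_cast hN
  set C := M.filter fun m' : ℤ => (N : ℤ) ∣ m - m' with hC
  -- the quotient map `m' ↦ (m' + K) / N` is injective on the class and lands in `[0, 2K/N]`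
  set f : ℤ → ℤ := fun m' => (m' + K) / N with hf
  have hinj : Set.InjOn f C := by
    intro m₁ hm₁ m₂ hm₂ hfeq
    have h1 := (Finset.mem_filter.1 (Finset.mem_coe.1 hm₁)).2
    have h2 := (Finset.mem_filter.1 (Finset.mem_coe.1 hm₂)).2
    -- same remainder mod `N`
    have hmod : (m₁ + K) % N = (m₂ + K) % N := by
      have hd : (N : ℤ) ∣ (m₂ + K) - (m₁ + K) := by
        have : (m₂ + K) - (m₁ + K) = (m - m₁) - (m - m₂) := by ring
        rw [this]; exact dvd_sub h1 h2
      exact Int.modEq_iff_dvd.2 hd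
    simp only [hf] at hfeq
    have : m₁ + K = m₂ + K := by rw [← Int.emod_add_mul_ediv (m₁ + K) N, ← Int.emod_add_mul_ediv (m₂ + K) N, hfeq, hmod]
    linarith
  have hmaps : ∀ m' ∈ C, f m' ∈ Finset.Icc (0 : ℤ) (2 * K / N) := by
    intro m' hm'
    have hm'M := (Finset.mem_filter.1 hm').1
    have hb := abs_le.1 (hM m' hm'M)
    refine Finset.mem_Icc.2 ⟨Int.ediv_nonneg (by linarith [hb.1]) hNpos.le, ?_⟩
    exact Int.ediv_le_ediv hNpos (by linarith [hb.2])
  have hcard : C.card ≤ (Finset.Icc (0 : ℤ) (2 * K / N)).card :=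
    Finset.card_le_card_of_injOn f hmaps hinj
  rw [Int.card_Icc] at hcard
  have h0 : (0 : ℤ) ≤ 2 * K / N := Int.ediv_nonneg (by positivity) hNpos.le
  have : ((2 * (K : ℤ) / N + 1 - 0).toNat : ℤ) = 2 * K / N + 1 := by
    rw [Int.toNat_of_nonneg (by linarith)]; ring
  calc (C.card : ℤ) ≤ ((2 * (K : ℤ) / N + 1 - 0).toNat : ℤ) := by exact_mod_cast hcard
    _ = 2 * K / N + 1 := this

/-- **The equispaced large sieve.**  For a finite `M ⊆ [−K, K]`, coefficients `a : ℤ → ℂ`, `N ≥ 1` and every real `u`,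
`Σ_{r<N} ‖Σ_{m∈M} a_m e(m(u + r/N))‖² ≤ (N + 2K)·Σ_{m∈M} ‖a_m‖²`: expanding the squares and summing over `r` kills the
pairs `m ≢ m′ (mod N)` (§1), and on the surviving pairs `‖a_m‖‖a_{m′}‖ ≤ ½(‖a_m‖² + ‖a_{m′}‖²)` with at most `2K/N + 1`
partners per class (`card_filter_dvd_sub_le`). [folklore] -/
theorem sum_sq_norm_trigEval_equispaced_le {N : ℕ} (hN : 0 < N) {K : ℕ} (M : Finset ℤ) (hM : ∀ m ∈ M, |m| ≤ K)
    (a : ℤ → ℂ) (u : ℝ) :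
    ∑ r ∈ Finset.range N, ‖∑ m ∈ M, a m * Complex.exp (2 * π * I * m * (u + r / N))‖ ^ 2 ≤
      ((N : ℝ) + 2 * K) * ∑ m ∈ M, ‖a m‖ ^ 2 := by
  classical
  have hNc : (N : ℂ) ≠ 0 := by exact_mod_cast hN.ne'
  have hNr : (0 : ℝ) < N := by exact_mod_cast hN
  -- Step 1: the complexified sum of squares, expanded and summed over `r`
  set e : ℤ → ℝ → ℂ := fun m y => Complex.exp (2 * π * I * m * y) with he
  have heconj : ∀ (m : ℤ) (y : ℝ), conj (e m y) = e (-m) y := by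
    intro m y
    simp only [he, ← Complex.exp_conj, map_mul, map_ofNat, Complex.conj_ofReal, Complex.conj_I, map_intCast,
      Int.cast_neg]
    congr 1; ring
  have hemul : ∀ (m m' : ℤ) (y : ℝ), e m y * e (-m') y = e (m - m') y := by
    intro m m' y
    simp only [he, ← Complex.exp_add]
    congr 1; push_cast; ring
  have hsq : ∀ r : ℕ, ((‖∑ m ∈ M, a m * e m (u + r / N)‖ ^ 2 : ℝ) : ℂ) =
      ∑ m ∈ M, ∑ m' ∈ M, a m * conj (a m') * e (m - m') (u + r / N) := by
    intro r
    rw [← Complex.normSq_eq_norm_sq, ← Complex.mul_conj, map_sum, Finset.sum_mul_sum]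
    refine Finset.sum_congr rfl fun m _ => Finset.sum_congr rfl fun m' _ => ?_
    rw [map_mul, heconj, ← hemul]; ring
  -- the character sum in the form needed
  have hchar : ∀ q : ℤ, ∑ r ∈ Finset.range N, e q (u + r / N) =
      e q u * (if (N : ℤ) ∣ q then (N : ℂ) else 0) := by
    intro q
    rw [← sum_range_exp_two_pi_mul_div hN q, Finset.mul_sum]
    refine Finset.sum_congr rfl fun r _ => ?_
    simp only [he, ← Complex.exp_add]
    congr 1; push_cast; ring
  have hsum : ((∑ r ∈ Finset.range N, ‖∑ m ∈ M, a m * e m (u + r / N)‖ ^ 2 : ℝ) : ℂ) =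
      ∑ m ∈ M, ∑ m' ∈ M, a m * conj (a m') * (e (m - m') u * (if (N : ℤ) ∣ m - m' then (N : ℂ) else 0)) := by
    rw [Complex.ofReal_sum]
    simp_rw [hsq]
    rw [Finset.sum_comm]
    refine Finset.sum_congr rfl fun m _ => ?_
    rw [Finset.sum_comm]
    refine Finset.sum_congr rfl fun m' _ => ?_
    rw [← Finset.mul_sum, hchar]
  -- Step 2: bound the surviving pairs
  have hbound : ‖∑ m ∈ M, ∑ m' ∈ M, a m * conj (a m') *
      (e (m - m') u * (if (N : ℤ) ∣ m - m' then (N : ℂ) else 0))‖ ≤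
      ∑ m ∈ M, ∑ m' ∈ M, if (N : ℤ) ∣ m - m' then (N : ℝ) * (‖a m‖ * ‖a m'‖) else 0 := by
    refine (norm_sum_le _ _).trans (Finset.sum_le_sum fun m _ => (norm_sum_le _ _).trans
      (Finset.sum_le_sum fun m' _ => ?_))
    have he1 : ‖e (m - m') u‖ = 1 := by
      simp only [he]
      rw [show (2 * π * I * ((m - m' : ℤ) : ℂ) * (u : ℂ) : ℂ) = ((2 * π * (m - m') * u : ℝ) : ℂ) * I by
        push_cast; ring, Complex.norm_exp_ofReal_mul_I]
    split_ifs with h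
    · rw [norm_mul, norm_mul, norm_mul, he1, one_mul, Complex.norm_conj, Complex.norm_natCast]; ring_nf; rfl
    · simp
  -- AM–GM and the class count
  have hamgm : ∑ m ∈ M, ∑ m' ∈ M, (if (N : ℤ) ∣ m - m' then (N : ℝ) * (‖a m‖ * ‖a m'‖) else 0) ≤
      ∑ m ∈ M, ∑ m' ∈ M, (if (N : ℤ) ∣ m - m' then (N : ℝ) * ‖a m‖ ^ 2 else 0) := by
    -- symmetrise: the relation `N ∣ m − m′` is symmetric
    have hsymm : ∑ m ∈ M, ∑ m' ∈ M, (if (N : ℤ) ∣ m - m' then (N : ℝ) * ‖a m'‖ ^ 2 else 0) =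
        ∑ m ∈ M, ∑ m' ∈ M, (if (N : ℤ) ∣ m - m' then (N : ℝ) * ‖a m‖ ^ 2 else 0) := by
      rw [Finset.sum_comm]
      refine Finset.sum_congr rfl fun m _ => Finset.sum_congr rfl fun m' _ => ?_
      have hiff : (N : ℤ) ∣ m' - m ↔ (N : ℤ) ∣ m - m' := by
        rw [show m' - m = -(m - m') by ring, dvd_neg]
      simp only [hiff]
    have h2 : ∑ m ∈ M, ∑ m' ∈ M, (if (N : ℤ) ∣ m - m' then (N : ℝ) * (‖a m‖ * ‖a m'‖) else 0) ≤
        ∑ m ∈ M, ∑ m' ∈ M, ((if (N : ℤ) ∣ m - m' then (N : ℝ) * ‖a m‖ ^ 2 else 0) +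
          (if (N : ℤ) ∣ m - m' then (N : ℝ) * ‖a m'‖ ^ 2 else 0)) / 2 := by
      refine Finset.sum_le_sum fun m _ => Finset.sum_le_sum fun m' _ => ?_
      split_ifs with h
      · have := two_mul_le_add_sq ‖a m‖ ‖a m'‖
        nlinarith [hNr]
      · simp
    refine h2.trans (le_of_eq ?_)
    simp only [add_div, Finset.sum_add_distrib]
    simp only [← Finset.sum_div]
    rw [hsymm]; ring
  have hclass : ∀ m ∈ M, ∑ m' ∈ M, (if (N : ℤ) ∣ m - m' then (N : ℝ) * ‖a m‖ ^ 2 else 0) ≤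
      ((N : ℝ) + 2 * K) * ‖a m‖ ^ 2 := by
    intro m hm
    rw [← Finset.sum_filter, Finset.sum_const, nsmul_eq_mul]
    have hc := card_filter_dvd_sub_le hN M hM m
    have hc' : ((M.filter fun m' : ℤ => (N : ℤ) ∣ m - m').card : ℝ) * N ≤ N + 2 * K := by
      have h1 : (((M.filter fun m' : ℤ => (N : ℤ) ∣ m - m').card : ℤ) * N : ℤ) ≤ (2 * K / N + 1) * N :=
        mul_le_mul_of_nonneg_right hc (by positivity)
      have h2 : ((2 * (K : ℤ) / N + 1) * N : ℤ) ≤ 2 * K + N := by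
        have := Int.ediv_mul_le (2 * (K : ℤ)) (b := N) (by exact_mod_cast hN.ne')
        linarith
      have h3 : (((M.filter fun m' : ℤ => (N : ℤ) ∣ m - m').card : ℤ) * N : ℤ) ≤ 2 * K + N := h1.trans h2
      have h4 : ((((M.filter fun m' : ℤ => (N : ℤ) ∣ m - m').card : ℤ) * N : ℤ) : ℝ) ≤ ((2 * K + N : ℤ) : ℝ) := by
        exact_mod_cast h3
      push_cast at h4
      linarith
    calc ((M.filter fun m' : ℤ => (N : ℤ) ∣ m - m').card : ℝ) * ((N : ℝ) * ‖a m‖ ^ 2)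
        = (((M.filter fun m' : ℤ => (N : ℤ) ∣ m - m').card : ℝ) * N) * ‖a m‖ ^ 2 := by ring
      _ ≤ ((N : ℝ) + 2 * K) * ‖a m‖ ^ 2 := mul_le_mul_of_nonneg_right hc' (sq_nonneg _)
  -- assemble
  have hreal : ∑ r ∈ Finset.range N, ‖∑ m ∈ M, a m * e m (u + r / N)‖ ^ 2 =
      ‖((∑ r ∈ Finset.range N, ‖∑ m ∈ M, a m * e m (u + r / N)‖ ^ 2 : ℝ) : ℂ)‖ := by
    rw [Complex.norm_real, Real.norm_of_nonneg (Finset.sum_nonneg fun r _ => sq_nonneg _)]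
  have hmain : ∑ r ∈ Finset.range N, ‖∑ m ∈ M, a m * e m (u + r / N)‖ ^ 2 ≤ ((N : ℝ) + 2 * K) * ∑ m ∈ M, ‖a m‖ ^ 2 := by
    rw [hreal, hsum]
    refine hbound.trans (hamgm.trans ?_)
    rw [Finset.mul_sum]
    exact Finset.sum_le_sum hclass
  simp only [he] at hmain
  push_cast at hmain ⊢
  exact hmain

/-! ## §3 Periodic weights against trigonometric polynomials -/

/-- A `1/N`-periodic function on `𝕋` is `r/N`-periodic for every `r ∈ ℕ`. [folklore] -/
theorem periodic_nsmul_of_periodic {w : UnitAddCircle → ℝ} {N : ℕ}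
    (hw : ∀ y : UnitAddCircle, w (y + (((1 : ℝ) / N : ℝ) : UnitAddCircle)) = w y) (r : ℕ) (y : UnitAddCircle) :
    w (y + (((r : ℝ) / N : ℝ) : UnitAddCircle)) = w y := by
  induction r with
  | zero => simp
  | succ r ih =>
    have e : ((((r + 1 : ℕ) : ℝ) / N : ℝ) : UnitAddCircle) =
        (((r : ℝ) / N : ℝ) : UnitAddCircle) + (((1 : ℝ) / N : ℝ) : UnitAddCircle) := by
      rw [← AddCircle.coe_add]; congr 1; push_cast; ring
    rw [e, ← add_assoc, hw, ih]

/-- The equispaced sieve on the circle: for `y ∈ 𝕋`, `Σ_{r<N} ‖c(y + r/N)‖² ≤ (N + 2K)·Σ‖a_m‖²`,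
`c = Σ_{m∈M} a_m e_m`, `M ⊆ [−K, K]`. [folklore] -/
theorem sum_sq_norm_trigPoly_translate_le {N : ℕ} (hN : 0 < N) {K : ℕ} (M : Finset ℤ) (hM : ∀ m ∈ M, |m| ≤ K)
    (a : ℤ → ℂ) (y : UnitAddCircle) :
    ∑ r ∈ Finset.range N, ‖∑ m ∈ M, a m * fourier m (y + (((r : ℝ) / N : ℝ) : UnitAddCircle))‖ ^ 2 ≤
      ((N : ℝ) + 2 * K) * ∑ m ∈ M, ‖a m‖ ^ 2 := by
  obtain ⟨u, rfl⟩ := QuotientAddGroup.mk_surjective y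
  have hx : (QuotientAddGroup.mk u : UnitAddCircle) = ((u : ℝ) : UnitAddCircle) := rfl
  have h := sum_sq_norm_trigEval_equispaced_le hN M hM a u
  refine le_of_eq_of_le (Finset.sum_congr rfl fun r _ => ?_) h
  congr 2
  refine Finset.sum_congr rfl fun m _ => ?_
  rw [hx, ← AddCircle.coe_add, fourier_coe_apply]
  congr 2; push_cast; ring

/-- **Periodic weights against trigonometric polynomials.**  Let `w ≥ 0` be a continuous `1/N`-periodic function on `𝕋`
(`N ≥ 1`) and `c = Σ_{m∈M} a_m e_m` a trigonometric polynomial with `M ⊆ [−K, K]`.  Then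
`∫_𝕋 w·‖c‖² ≤ (1 + 2K/N)·(∫_𝕋 w)·Σ_{m∈M}‖a_m‖²`: by translation invariance and periodicity
`∫ w‖c‖² = ∫ w(y)‖c(y + r/N)‖² dy` for each `r < N`, and the equispaced sieve bounds the average over `r`.
[cite: Grafakos2014, Prop. 3.2.7 (3)] -/
theorem integral_periodic_mul_sq_norm_trigPoly_le {N : ℕ} (hN : 0 < N) {K : ℕ} (M : Finset ℤ)
    (hM : ∀ m ∈ M, |m| ≤ K) (a : ℤ → ℂ) {w : UnitAddCircle → ℝ} (hwc : Continuous w) (hw0 : ∀ y, 0 ≤ w y)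
    (hw : ∀ y : UnitAddCircle, w (y + (((1 : ℝ) / N : ℝ) : UnitAddCircle)) = w y) :
    ∫ y : UnitAddCircle, w y * ‖∑ m ∈ M, a m * fourier m y‖ ^ 2 ≤
      (1 + 2 * K / N) * (∫ y : UnitAddCircle, w y) * ∑ m ∈ M, ‖a m‖ ^ 2 := by
  have hNr : (0 : ℝ) < N := by exact_mod_cast hN
  set c : UnitAddCircle → ℂ := fun y => ∑ m ∈ M, a m * fourier m y with hc
  have hcc : Continuous c := continuous_finsetSum _ fun m _ => continuous_const.mul (fourier m).continuous
  have hI : ∀ {f : UnitAddCircle → ℝ}, Continuous f → Integrable f := fun hf =>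
    hf.integrable_of_hasCompactSupport (HasCompactSupport.of_compactSpace _)
  -- each translate has the same weighted energy
  have htrans : ∀ r : ℕ, ∫ y : UnitAddCircle, w y * ‖c (y + (((r : ℝ) / N : ℝ) : UnitAddCircle))‖ ^ 2 =
      ∫ y : UnitAddCircle, w y * ‖c y‖ ^ 2 := by
    intro r
    have h1 : (fun y : UnitAddCircle => w y * ‖c (y + (((r : ℝ) / N : ℝ) : UnitAddCircle))‖ ^ 2) =
        fun y => (fun z : UnitAddCircle => w z * ‖c z‖ ^ 2) (y + (((r : ℝ) / N : ℝ) : UnitAddCircle)) := by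
      funext y
      simp only
      rw [periodic_nsmul_of_periodic hw r y]
    rw [h1]
    exact integral_add_right_eq_self (μ := (volume : Measure UnitAddCircle)) (fun z : UnitAddCircle => w z * ‖c z‖ ^ 2) _
  -- sum over `r < N`
  have hsumint : (N : ℝ) * ∫ y : UnitAddCircle, w y * ‖c y‖ ^ 2 =
      ∫ y : UnitAddCircle, w y * ∑ r ∈ Finset.range N, ‖c (y + (((r : ℝ) / N : ℝ) : UnitAddCircle))‖ ^ 2 := by
    have h1 : (N : ℝ) * ∫ y : UnitAddCircle, w y * ‖c y‖ ^ 2 =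
        ∑ r ∈ Finset.range N, ∫ y : UnitAddCircle, w y * ‖c (y + (((r : ℝ) / N : ℝ) : UnitAddCircle))‖ ^ 2 := by
      simp_rw [htrans]
      rw [Finset.sum_const, Finset.card_range, nsmul_eq_mul]
    rw [h1, ← integral_finsetSum]
    · refine integral_congr_ae (Eventually.of_forall fun y => ?_)
      simp only [Finset.mul_sum]
    · intro r _
      exact hI (hwc.mul ((hcc.comp (continuous_id.add continuous_const)).norm.pow 2))
  -- pointwise sieve under the integral
  have hpt : ∀ y : UnitAddCircle, w y * ∑ r ∈ Finset.range N, ‖c (y + (((r : ℝ) / N : ℝ) : UnitAddCircle))‖ ^ 2 ≤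
      w y * (((N : ℝ) + 2 * K) * ∑ m ∈ M, ‖a m‖ ^ 2) := fun y =>
    mul_le_mul_of_nonneg_left (sum_sq_norm_trigPoly_translate_le hN M hM a y) (hw0 y)
  have hle : ∫ y : UnitAddCircle, w y * ∑ r ∈ Finset.range N, ‖c (y + (((r : ℝ) / N : ℝ) : UnitAddCircle))‖ ^ 2 ≤
      ∫ y : UnitAddCircle, w y * (((N : ℝ) + 2 * K) * ∑ m ∈ M, ‖a m‖ ^ 2) := by
    refine integral_mono ?_ ((hI hwc).mul_const _) hpt
    exact hI (hwc.mul (continuous_finsetSum _ fun r _ =>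
      (hcc.comp (continuous_id.add continuous_const)).norm.pow 2))
  rw [integral_mul_const] at hle
  -- divide by `N`
  have hkey : (N : ℝ) * ∫ y : UnitAddCircle, w y * ‖c y‖ ^ 2 ≤
      (∫ y : UnitAddCircle, w y) * (((N : ℝ) + 2 * K) * ∑ m ∈ M, ‖a m‖ ^ 2) := by rw [hsumint]; exact hle
  have hw_int0 : 0 ≤ ∫ y : UnitAddCircle, w y := integral_nonneg hw0
  have hA0 : 0 ≤ ∑ m ∈ M, ‖a m‖ ^ 2 := Finset.sum_nonneg fun m _ => sq_nonneg _
  rw [show (1 + 2 * (K : ℝ) / N) * (∫ y : UnitAddCircle, w y) * ∑ m ∈ M, ‖a m‖ ^ 2 =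
    ((∫ y : UnitAddCircle, w y) * (((N : ℝ) + 2 * K) * ∑ m ∈ M, ‖a m‖ ^ 2)) / N by field_simp]
  rw [le_div_iff₀ hNr]
  linarith

end Summit.AnomalousDissipation.AnomalousDissipation.Theorems.SawtoothPulseCascade.K1Start
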